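import Mathlib
import Literature.AlgebraicGeometry.Resolution.ResolutionOfSingularities
import Literature.AlgebraicGeometry.Resolution.AlterationsLemma32
import Literature.AlgebraicGeometry.Resolution.ProjectiveSpaceRegular
import HarnessLib

/-!
# Hu's Γ-schemes on the chart `p₁₂₃ ≠ 0` of `Gr(3, n)` and the claimed universal resolution (Hu 2025, Thm. 1.3)

Topic: `Literature/AlgebraicGeometry/Resolution`. Y. Hu, *Universal Characteristic-free
Resolution of Singularities, I* (arXiv:2507.21400, 2025; unrefereed, Part I of II) considers, for
a vector space `E` of dimension `n` over `𝔽 ∈ {ℚ, 𝔽_p}`, the affine chart `𝕌 = (p₁₂₃ ≠ 0)` of the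
Plücker projective space `ℙ(∧³E)` with its de-homogenised coordinates
`var_𝕌 = {x_u : u ∈ I_{3,n} ∖ {(123)}}`, and for ANY subset `Γ ⊆ var_𝕌` the **Γ-scheme**
`Z_Γ := {x_u = 0 : x_u ∈ Γ} ∩ Gr^{3,E} ∩ 𝕌` (§1.5 p. 8, §2.1 p. 10), the closed subscheme of the
chart `𝕌 ∩ Gr^{3,E}` cut out by the Plücker variables in `Γ`. By Mnëv–Lafforgue universality
(Lafforgue 2003, Thm. I.14; Lee–Vakil 2012) the Γ-schemes attached to matroids carry every
singularity type of finite type over `ℤ` up to smooth morphisms (Hu 2025, Thm. 1.1). Hu's main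
theorem on the Grassmannian (Thm. 1.3, p. 8): *"Let `𝔽` be either `ℚ` or a finite field with `p`
elements where `p` is a prime number. Let `Γ` be any subset of `var_𝕌`. Assume that `Z_Γ` is
integral. Let `Z̃_{ℓ,Γ}` be the `ℓ`-transform of `Z_Γ` in `Ṽ_ℓ`. Then, `Z̃_{ℓ,Γ}` is smooth over `𝔽`.
In particular, the induced morphism `Z̃†_{ℓ,Γ} → Z_Γ` is a resolution over `𝔽`, provided that `Z_Γ`
is singular"* — where (§1.5, p. 8) `Z̃†_{ℓ,Γ}` is a connected component of the smooth `Z̃_{ℓ,Γ}` and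
`Z̃†_{ℓ,Γ} → Z_Γ` is surjective, projective and birational.

## The `[I₃ | A]` model (how the tree states it)

The chart `𝕌 ∩ Gr^{3,E}` is the affine space `𝔸^{3(n-3)}` of `3 × n` matrices `[I₃ | A]` (the
`(123)`-primary Plücker relations `F̄_{(123),iuv}`, `F̄_{(123),abc}` of §2.2 (p. 10) solve every
other `x_u` polynomially in the `3(n-3)` variables `x_{12u}, x_{13u}, x_{23u}`, which are, up to
sign, the entries of `A`), and on it the Plücker coordinate `x_u` is the `3 × 3` minor of
`[I₃ | A]` on the columns `u`. So with `m = n - 3`, `Z_Γ = Spec (𝔽[a_ij : Fin 3 × Fin m] ⧸ (minors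
of [I₃ | A] indexed by Γ))` = `Spec (HuGamma.ring 𝔽 m Γ)` below. We index minors by ALL maps
`u : Fin 3 → Fin 3 ⊕ Fin m` (ordered column triples, repetitions allowed): a repeated column gives
the minor `0` (no condition), a permutation gives `±` the same generator, and the frame triple
gives the unit `±1` (empty scheme, excluded by the integrality hypothesis) — so the family of
integral `Spec (HuGamma.ring 𝔽 m Γ)` is exactly Hu's family of integral `Z_Γ`, `Γ ⊆ var_𝕌`, with
`n = 3 + m`.

## Content

* `HuGamma.frameMatrix R m`, `HuGamma.minor R m u`, `HuGamma.ideal R m Γ`, `HuGamma.ring R m Γ` —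
  the Γ-scheme's coordinate ring over any commutative ring `R`.
* `Hu2025IntegralGammaSchemeResolution` — the CLAIM (D-0012, `@[claim "Hu2025" "under-review"]`),
  the "in particular" clause of Thm. 1.3 over `𝔽 = 𝔽_p`: an integral `Z_Γ` admits a proper
  birational `π : Z' → Z_Γ` with `Z'` smooth over `𝔽_p`. NOT proved here (300 pp. of explicit
  `ϑ`/`℘`/`ℓ`-blow-ups and Jacobian computations; Part II pending; p. 9 records an error in an
  earlier version); it never settles anything by itself.
* `Hu2025IntegralGammaSchemeResolution.hasResolution` — PROVED glue: the claim gives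
  `Scheme.HasResolution (Spec (HuGamma.ring (ZMod p) m Γ))` in the tree's sense (regular source:
  smooth over the regular scheme `Spec 𝔽_p` is regular, EGA IV₄ 17.5.8 (iii),
  `Scheme.IsRegular.of_smooth`).

## Design choices / what is NOT here

* Only `𝔽 = 𝔽_p` is stated (`-- TODO(general form)`: Hu also covers `𝔽 = ℚ`, asserts smoothness of
  the whole `ℓ`-transform `Z̃_{ℓ,Γ}`, and surjectivity + projectivity of `Z̃† → Z_Γ`; none of Hu's
  tower `Ṽ_ℓ → … → 𝕌` is rendered). "Birational" is the tree's `IsBirational` (isomorphism over a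
  dense open with dense preimage), which for a proper morphism between integral schemes of finite
  type over a field is the printed notion (Stacks 01RN/0BAC).
* The hypothesis "`Z_Γ` singular" of the printed clause is dropped: for `Z_Γ` smooth the identity
  is such a `π`, so the statement below is equivalent to the printed one.
* This is the ENGINE stub `stub_integralGammaRes` of the crux `UniversalCells.MatroidCellRes`
  (Summits side) by design of that route; it is recorded here as the claim it is so that the trust
  base of anything using it is this one name.
-/

noncomputable section

open CategoryTheory AlgebraicGeometry

namespace Literature.AlgebraicGeometry.Resolution

universe u

namespace HuGamma

/-- The universal `3 × (3 + m)` matrix `[I₃ | A]` over `R[a_ij]`: the chart `p₁₂₃ ≠ 0` of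
`Gr(3, 3 + m)` (Hu's `𝕌 ∩ Gr^{3,E}`, §2.2). [cite: Hu2025, §2.2 (p. 10)] -/
def frameMatrix (R : Type u) [CommRing R] (m : ℕ) :
    Matrix (Fin 3) (Fin 3 ⊕ Fin m) (MvPolynomial (Fin 3 × Fin m) R) :=
  Matrix.fromCols 1 (Matrix.of fun i j => MvPolynomial.X (i, j))

/-- The `3 × 3` minor of `[I₃ | A]` on the ordered column triple `u` — on the chart `p₁₂₃ ≠ 0`
this is the de-homogenised Plücker coordinate `x_u` (`0` if `u` repeats a column, `±1` on the
frame). [cite: Hu2025, §2.2 (p. 10)] -/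
def minor (R : Type u) [CommRing R] (m : ℕ) (u : Fin 3 → Fin 3 ⊕ Fin m) :
    MvPolynomial (Fin 3 × Fin m) R :=
  ((frameMatrix R m).submatrix id u).det

/-- The ideal of the Γ-scheme `Z_Γ ⊆ 𝔸^{3m}_R`: the minors indexed by `Γ`.
[cite: Hu2025, §1.5 (p. 8) and §2.3 (p. 10)] -/
def ideal (R : Type u) [CommRing R] (m : ℕ) (Γ : Set (Fin 3 → Fin 3 ⊕ Fin m)) :
    Ideal (MvPolynomial (Fin 3 × Fin m) R) :=
  Ideal.span (minor R m '' Γ)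

/-- Coordinate ring of Hu's Γ-scheme `Z_Γ = {x_u = 0 : u ∈ Γ} ∩ Gr^{3,E} ∩ (p₁₂₃ ≠ 0)` in the
`[I₃ | A]` model: `R[a_ij : Fin 3 × Fin m] ⧸ (Γ-minors)`. [cite: Hu2025, §2.1–2.3 (p. 10)] -/
abbrev ring (R : Type u) [CommRing R] (m : ℕ) (Γ : Set (Fin 3 → Fin 3 ⊕ Fin m)) : Type u :=
  MvPolynomial (Fin 3 × Fin m) R ⧸ ideal R m Γ

/-- The structure morphism `Z_Γ ⟶ Spec R`. [folklore] -/
def toBase (R : Type u) [CommRing R] (m : ℕ) (Γ : Set (Fin 3 → Fin 3 ⊕ Fin m)) :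
    Spec (.of (ring R m Γ)) ⟶ Spec (.of R) :=
  Spec.map (CommRingCat.ofHom (algebraMap R (ring R m Γ)))

end HuGamma

/-- CLAIM (unrefereed preprint, D-0012) — **Hu 2025, Thm. 1.3, "in particular" clause, over
`𝔽_p`**: *"Let `𝔽` be either `ℚ` or a finite field with `p` elements … Let `Γ` be any subset of
`var_𝕌`. Assume that `Z_Γ` is integral. … the induced morphism `Z̃†_{ℓ,Γ} → Z_Γ` is a resolution
over `𝔽`, provided that `Z_Γ` is singular"*, with `Z̃†_{ℓ,Γ}` smooth over `𝔽` and `Z̃†_{ℓ,Γ} → Z_Γ`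
projective and birational (§1.5, p. 8). Stated in the `[I₃ | A]` model of the chart (module
docstring): for every prime `p`, every `m` and every set `Γ` of column triples, if
`𝔽_p[A] ⧸ (Γ-minors)` is a domain then there is a proper birational `π : Z' → Spec (𝔽_p[A] ⧸ (Γ-minors))`
whose source is smooth over `𝔽_p`. The singular/smooth dichotomy of the print is absorbed (the
identity serves when `Z_Γ` is smooth). A CLAIM under review — never a hypothesis-free input.
[cite: Hu2025, Thm. 1.3 (p. 8) with §1.5 (p. 8) and §2.2–2.3 (p. 10)] -/
@[claim "Hu2025" "under-review"]
def Hu2025IntegralGammaSchemeResolution : Prop :=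
  ∀ (p : ℕ) [Fact p.Prime] (m : ℕ) (Γ : Set (Fin 3 → Fin 3 ⊕ Fin m)),
    IsDomain (HuGamma.ring (ZMod p) m Γ) →
      ∃ (Z' : Scheme.{0}) (π : Z' ⟶ Spec (.of (HuGamma.ring (ZMod p) m Γ))),
        IsProper π ∧ IsBirational π ∧ Smooth (π ≫ HuGamma.toBase (ZMod p) m Γ)

-- TODO(general form): Hu2025 Thm. 1.3 also covers `𝔽 = ℚ`, and asserts that the whole
-- ℓ-transform `Z̃_{ℓ,Γ}` is smooth and that `Z̃†_{ℓ,Γ} → Z_Γ` is surjective and projective.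

/-- **Glue (proved): Hu's claim gives a resolution in the tree's sense.** Under
`Hu2025IntegralGammaSchemeResolution`, every integral Γ-scheme over `𝔽_p` has
`Scheme.HasResolution`: a scheme smooth over the regular scheme `Spec 𝔽_p` is regular
(EGA IV₄ 17.5.8 (iii), `Scheme.IsRegular.of_smooth`). [cite: Grothendieck1967, Prop. 17.5.8 (iii)] -/
theorem Hu2025IntegralGammaSchemeResolution.hasResolution
    (h : Hu2025IntegralGammaSchemeResolution) (p : ℕ) [Fact p.Prime] (m : ℕ)
    (Γ : Set (Fin 3 → Fin 3 ⊕ Fin m)) (hdom : IsDomain (HuGamma.ring (ZMod p) m Γ)) :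
    Scheme.HasResolution (Spec (.of (HuGamma.ring (ZMod p) m Γ))) := by
  obtain ⟨Z', π, hπ, hbir, hsm⟩ := h p m Γ hdom
  haveI := hsm
  have hbase : Scheme.IsRegular (Spec (.of (ZMod p))) := Scheme.isRegular_Spec _
  exact ⟨Z', π, hπ, hbir, Scheme.IsRegular.of_smooth (π ≫ HuGamma.toBase (ZMod p) m Γ) hbase⟩

end Literature.AlgebraicGeometry.Resolution

end
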